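/-
Origin: expansion seat `prover-pub-hodgecm-mc-binder-2-g7-0`, handover #13 19:25Z md5 264c157a5400 (119 l.; imports `HodgeCM.PerL34.ArchCHyperbolic` + twin `KonnoKonno2007/JunctionSwapBargmann`, both in PKG — installable any run, DROP-ONLY-THIS-ROW on bounce; DICTIONARY printed ↔ kernel for the hyperbolic slot operator: `mixedToDPIdx Q' eA r₀ s₀ : MixedVar → DPIdx P' Q' R' S'` (`z_a ↦ (eA a, r₀)` same-sign, `w_a ↦ (eA a, s₀)` mixed; injective), `rename_mixedToDPIdx_P`, **`rename_mixedToDPIdx_printedHyp`**: `rename ι (printedHyp (−π⁻¹) F) = −I • Σ_{p : P'} hypPairSymb (inl (inl (p, r₀))) (inr (inl (p, s₀))) (rename ι F)`, **`hypOpWGen_binvPi_rename_printedHyp [IsEmpty Q']`**: `hypOpWGen P' Q' r₀ s₀ (binvPi (rename ι F)) = binvPi (rename ι (printedHyp (−π⁻¹) F))` — pv06's PRINTED hyperbolic operator (Adams parameter λ_b := −π⁻¹) IS Konno–Konno's W-boost generator on the printed vectors; mirror `lean -o` rc 0 / 0 warn / 12.5 s, `#print axioms` trio (`g7/certs/HypDictionary_mirror.txt`))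 (`HOME/mc/pub-hodgecm-mc-binder-2/g7/pkg/HodgeCM/Model/HypCensus/HypDictionary.lean`, md5 264c157a, 119 lines);
landed by the gen-13 packager (p-g13) in gate run 37 as `HodgeCM/Model/HypCensus/HypDictionary.lean` (verbatim).
-/
/-
Origin: speedrun cell pub-hodgecm, MODEL-CONSTRUCTION sub-cell, lineage mc-binder-2 (rows A12/A34 of the binder ledger:
`hyp12` / `hyp34`), seat prover-pub-hodgecm-mc-binder-2-g7-0 (gen 7), 2026-08-19.  Target in PKG:
`HodgeCM/Model/HypCensus/HypDictionary.lean` (NEW additive leaf; imports PKG `HodgeCM.PerL34.ArchCHyperbolic` (pv06, RUN 31) and the K-1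
twin of `KonnoKonno2007/JunctionSwapBargmann` (in PKG since RUN 35)).  KERNEL only: 0 records / named facts / proof holes.
-/
import Summits.HodgeConjecture.HodgeCM.PerL34.ArchCHyperbolic
import Literature.RepresentationTheory.KonnoKonno2007.JunctionSwapBargmann

/-!
# Census kit (rows A12/A34), dictionary: pv06's PRINTED hyperbolic Fock operator IS Konno–Konno's `W`-side boost symbol, at `λ = −π⁻¹`

The census field `HypSmoothSide.smooth` differentiates along the hyperbolic slot operator `hypX ⟨b,u⟩ = slot b (printedHypM (lam b))`
(PKG `PerL34/ArchCHyperbolic`, pv06), where `printedHyp λ = (i/λ)·(P·_) + iλ·Σ_a ∂_{z_a}∂_{w_a}` on the mixed model `ℂ[z_a, w_a]_{a : Fin 3}`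
of a `Σ₁₂` place (pv12's printed dictionary of [Ad07]).  The kit's kernel files (`SmoothBlock`, `SmoothTheta`, `InsBlock`) deliver the
slope with limit `hypOpWGen Φ₁ ⊠ Φ₂` in Konno–Konno's block frame, and the tree computes `hypOpWGen` on Fock vectors:
`hypOpWGen (binvPi F) = binvPi (I • (Σ_q … − Σ_p hypPairSymb (z_p) (w_p) F))`, `hypPairSymb k k' F = π X_k X_{k'} F + π⁻¹ ∂_k ∂_{k'} F`
(`JunctionSwapBargmann.hypOpWGen_binvPi_frame`).  This leaf proves that the two explicit operators AGREE, as polynomial operators,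
under the obvious identification of variables — for the Adams parameter **`λ = −π⁻¹`** (the census's free datum `lam b`):

* §1 `mixedToDPIdx Q' eA r₀ s₀ : MixedVar → DPIdx P' Q' R' S'` (`z_a ↦ (eA a, r₀)` in the same-sign block, `w_a ↦ (eA a, s₀)` in the mixed
  block; `Q' = ∅`-type slots, `eA : Fin 3 ≃ P'`), injective;
* §2 **`rename_mixedToDPIdx_printedHyp`**: `rename ι (printedHyp (−π⁻¹) F) = −I • Σ_{p : P'} hypPairSymb (inl (inl (p, r₀))) (inr (inl (p, s₀))) (rename ι F)`;
* §3 **`hypOpWGen_binvPi_rename_printedHyp`** (`Q'` empty): `hypOpWGen P' Q' r₀ s₀ (binvPi (rename ι F)) = binvPi (rename ι (printedHyp (−π⁻¹) F))`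
  — the printed operator and the kernel boost generator COINCIDE on the printed vectors.  (The lowering coefficient `(k+1)(k+3)` of
  `printedHyp_P_pow_succ` is Konno–Konno's `N(N+m−1)` at `N = k+1`, `m = 3`: the two formulas are the same oscillator representation.)

Nothing here is a claim of PerL/QW8: both operators are the package's/tree's own definitions; [Ad07]/[Folland1989 (4.24)] are provenance.
Style lint (L-notation): no `local notation`.
-/

set_option autoImplicit false

noncomputable section

open MvPolynomial Complex
open scoped BigOperators
open Literature.Analysis.SegalBargmann
open Literature.RepresentationTheory.KonnoKonno2007 Literature.RepresentationTheory.KonnoKonno2007.RealDualPair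
open HodgeCM.PerL34.Fock HodgeCM.PerL34.Fock.PrintDict

namespace HodgeCM.Model.HypCensus

section Dictionary

variable {P' R' S' : Type} [Fintype P'] [DecidableEq P'] [Fintype R'] [DecidableEq R'] [Fintype S'] [DecidableEq S']
variable (Q' : Type) (eA : Fin 3 ≃ P') (r₀ : R') (s₀ : S')

/-! ## §1 The identification of variables -/

/-- **the printed variables in Konno–Konno's block index**: `z_a ↦ (eA a, r₀)` (same-sign block `P × R`), `w_a ↦ (eA a, s₀)` (mixed
block `P × S`). -/
def mixedToDPIdx : HodgeCM.PerL34.Fock.MixedVar → DPIdx P' Q' R' S'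
  | Sum.inl a => Sum.inl (Sum.inl (eA a, r₀))
  | Sum.inr a => Sum.inr (Sum.inl (eA a, s₀))

omit [Fintype P'] [DecidableEq P'] [Fintype R'] [DecidableEq R'] [Fintype S'] [DecidableEq S'] in
/-- (Ported verbatim from the HodgeCMPerL package; no docstring in the source.) -/
@[simp] theorem mixedToDPIdx_inl (a : Fin 3) : mixedToDPIdx Q' eA r₀ s₀ (Sum.inl a) = Sum.inl (Sum.inl (eA a, r₀)) := rfl

omit [Fintype P'] [DecidableEq P'] [Fintype R'] [DecidableEq R'] [Fintype S'] [DecidableEq S'] in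
/-- (Ported verbatim from the HodgeCMPerL package; no docstring in the source.) -/
@[simp] theorem mixedToDPIdx_inr (a : Fin 3) : mixedToDPIdx Q' eA r₀ s₀ (Sum.inr a) = Sum.inr (Sum.inl (eA a, s₀)) := rfl

omit [Fintype P'] [DecidableEq P'] [Fintype R'] [DecidableEq R'] [Fintype S'] [DecidableEq S'] in
/-- the identification of variables is injective. -/
theorem mixedToDPIdx_injective : Function.Injective (mixedToDPIdx Q' eA r₀ s₀) := by
  rintro (a | a) (b | b) h
  · simp only [mixedToDPIdx_inl, Sum.inl.injEq, Prod.mk.injEq, EmbeddingLike.apply_eq_iff_eq, and_true] at h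
    rw [h]
  · exact absurd h (by simp [mixedToDPIdx])
  · exact absurd h (by simp [mixedToDPIdx])
  · simp only [mixedToDPIdx_inr, Sum.inr.injEq, Sum.inl.injEq, Prod.mk.injEq, EmbeddingLike.apply_eq_iff_eq, and_true] at h
    rw [h]

/-! ## §2 The printed hyperbolic operator read in the block index -/

omit [DecidableEq P'] [Fintype R'] [DecidableEq R'] [Fintype S'] [DecidableEq S'] in
/-- `P = Σ_a z_a w_a` reads as `Σ_{p : P'} X_{(p,r₀)} X_{(p,s₀)}`. -/
theorem rename_mixedToDPIdx_P :
    rename (mixedToDPIdx Q' eA r₀ s₀) HodgeCM.PerL34.Fock.P =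
      ∑ p : P', X (Sum.inl (Sum.inl (p, r₀)) : DPIdx P' Q' R' S') * X (Sum.inr (Sum.inl (p, s₀))) := by
  rw [HodgeCM.PerL34.Fock.P, map_sum]
  simp only [HodgeCM.PerL34.Fock.mz, HodgeCM.PerL34.Fock.mw, map_mul, rename_X, mixedToDPIdx_inl, mixedToDPIdx_inr]
  exact Fintype.sum_equiv eA _ _ fun a => rfl

omit [DecidableEq P'] [Fintype R'] [DecidableEq R'] [Fintype S'] [DecidableEq S'] in
/-- **the printed hyperbolic operator at `λ = −π⁻¹` is `−i Σ_p hypPairSymb(z_p, w_p)` in the block index.**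
[Ad07 via pv12/pv06 `printedHyp_eq_raise_add_lower`; Folland1989 (4.24) via `hypPairSymb`] -/
theorem rename_mixedToDPIdx_printedHyp (F : HodgeCM.PerL34.Fock.MixedModel) :
    rename (mixedToDPIdx Q' eA r₀ s₀) (printedHyp (-((Real.pi : ℂ))⁻¹) F) =
      -I • ∑ p : P', hypPairSymb (Sum.inl (Sum.inl (p, r₀)) : DPIdx P' Q' R' S') (Sum.inr (Sum.inl (p, s₀)))
        (rename (mixedToDPIdx Q' eA r₀ s₀) F) := by
  rw [printedHyp_eq_raise_add_lower, LinearMap.add_apply, LinearMap.smul_apply, LinearMap.smul_apply,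
    LinearMap.mulLeft_apply, LinearMap.coe_sum, Finset.sum_apply, map_add, map_smul, map_smul, map_mul,
    rename_mixedToDPIdx_P, map_sum]
  simp only [Module.End.mul_apply, dz_apply, hypPairSymb, Finset.smul_sum, Finset.sum_add_distrib, smul_add,
    Finset.sum_mul, ← pderiv_rename (mixedToDPIdx_injective Q' eA r₀ s₀), mixedToDPIdx_inl, mixedToDPIdx_inr,
    inv_neg, inv_inv, mul_neg, neg_smul, smul_smul, mul_assoc]
  congr 1
  · refine Finset.sum_congr rfl fun p _ => ?_
    rw [neg_mul, neg_smul, mul_comm I]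
  · exact Fintype.sum_equiv eA _ _ fun a => by rw [neg_mul, neg_smul, mul_comm I]

/-! ## §3 The printed operator IS the kernel boost generator on printed vectors (`Q' = ∅`: `V_v` definite) -/

omit [DecidableEq P'] in
/-- **DICTIONARY**: on the Bargmann-inverse image of a printed polynomial, Konno–Konno's `W`-side boost generator acts by the
printed hyperbolic operator at `λ = −π⁻¹`:
`hypOpWGen (binvPi (rename ι F)) = binvPi (rename ι (printedHyp (−π⁻¹) F))`. [Folland1989, (4.24); Ad07 via pv12/pv06] -/
theorem hypOpWGen_binvPi_rename_printedHyp [DecidableEq P'] [Fintype Q'] [DecidableEq Q'] [IsEmpty Q']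
    (F : HodgeCM.PerL34.Fock.MixedModel) :
    hypOpWGen P' Q' r₀ s₀ (binvPi (rename (mixedToDPIdx Q' eA r₀ s₀) F)) =
      binvPi (rename (mixedToDPIdx Q' eA r₀ s₀) (printedHyp (-((Real.pi : ℂ))⁻¹) F)) := by
  rw [hypOpWGen_binvPi_frame, rename_mixedToDPIdx_printedHyp, Fintype.sum_empty, zero_sub, smul_neg, neg_smul]

end Dictionary

end HodgeCM.Model.HypCensus

end
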